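import Summits.Ventures.PercRepro.PuncturedLYMTwoCoHypGenSeq

/-!
# PercRepro — TWO CO-HYPERPLANES OF ANY INTERSECTION, PART 4: THE ROW AND COLUMN IDENTITIES OF THE EXPLICIT FLOW
(p10, gen 35)

Arithmetic only, continuing part 3.  With `#A = m₁ − s`, `#B = m₂ − s`:
* **`w3_row`** — every realisable row sums to `1` (type I / type II / corner / interior, and the mirrors);
* `w3_sup_*` — where the weights are the superposition;
* `col_typeI`, `col_typeII` — the untouched columns `(#A − 1, b', s)` and `(#A, b', s − 1)` above the corrected rows:
  the `+B` correction of the row at `b' − 1` and the `+R` correction of the row at `b'` cancel term for term;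
* `col_corner3` — the corner column `(#A − 1, #B − 1, s)` when `#A + #B + s = j + 2`;
* **`w3_col`** — every realisable untouched column sums to `twoK`;  **`w3_top₁`** / **`w3_top₂`** — the touched columns
— the remaining identity hypotheses of `puncturedNMP_gen_of_seq`.  Nothing here asserts (SP).
-/

namespace PercRepro.PuncturedLYM

open Finset

/-! ### Where the weights are the superposition -/

/-- `w3A a b d` is the superposition unless the row `(a, b, d)` is corrected on its `+A` edges. -/
theorem w3A_sup {n j m₁ m₂ s a b d : ℕ} (h1 : ¬ (a + 1 = m₁ - s ∧ d = s)) (h2 : ¬ (b + 1 = m₂ - s ∧ d = s))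
    (h3 : ¬ (b = m₂ - s ∧ d + 1 = s)) : w3A n j m₁ m₂ s a b d = supA n j m₁ m₂ (a + d) (b + d) := by
  unfold w3A
  split_ifs
  rfl

/-- `w3B a b d` is the superposition unless the row `(a, b, d)` is corrected on its `+B` edges. -/
theorem w3B_sup {n j m₁ m₂ s a b d : ℕ} (h1 : ¬ (b + 1 = m₂ - s ∧ d = s)) (h2 : ¬ (a + 1 = m₁ - s ∧ d = s))
    (h3 : ¬ (a = m₁ - s ∧ d + 1 = s)) : w3B n j m₁ m₂ s a b d = supB n j m₁ m₂ (a + d) (b + d) := by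
  unfold w3B
  split_ifs
  rfl

/-- `w3D a b d` is the superposition unless the row `(a, b, d)` is of type II. -/
theorem w3D_sup {n j m₁ m₂ s a b d : ℕ} (h1 : ¬ (a = m₁ - s ∧ d + 1 = s ∧ b ≠ m₂ - s))
    (h2 : ¬ (b = m₂ - s ∧ d + 1 = s ∧ a ≠ m₁ - s)) : w3D n j m₁ m₂ s a b d = supD n j m₁ m₂ (a + d) (b + d) := by
  unfold w3D
  split_ifs
  rfl

/-- `w3R a b d` is the superposition unless the row `(a, b, d)` is corrected. -/
theorem w3R_sup {n j m₁ m₂ s a b d : ℕ} (h1 : ¬ (a + 1 = m₁ - s ∧ d = s)) (h2 : ¬ (b + 1 = m₂ - s ∧ d = s))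
    (h3 : ¬ (a = m₁ - s ∧ d + 1 = s ∧ b ≠ m₂ - s)) (h4 : ¬ (b = m₂ - s ∧ d + 1 = s ∧ a ≠ m₁ - s)) :
    w3R n j m₁ m₂ s a b d = supR n j m₁ m₂ (a + d) (b + d) := by
  unfold w3R
  split_ifs <;> first | rfl | (exfalso; omega)

/-- `(a' : ℚ) * w3A (a' − 1) b' d'` is the superposition term unless the row `(a' − 1, b', d')` is corrected. -/
theorem coef_w3A {n j m₁ m₂ s a' b' d' : ℕ} (h1 : ¬ (a' = m₁ - s ∧ d' = s))
    (h2 : ¬ (b' + 1 = m₂ - s ∧ d' = s)) (h3 : ¬ (b' = m₂ - s ∧ d' + 1 = s)) :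
    (a' : ℚ) * w3A n j m₁ m₂ s (a' - 1) b' d' = (a' : ℚ) * supA n j m₁ m₂ (a' - 1 + d') (b' + d') := by
  rcases Nat.eq_zero_or_pos a' with h0 | hpos
  · subst h0
    simp
  · rw [w3A_sup (by omega) h2 h3]

/-- `(b' : ℚ) * w3B a' (b' − 1) d'` is the superposition term unless the row `(a', b' − 1, d')` is corrected. -/
theorem coef_w3B {n j m₁ m₂ s a' b' d' : ℕ} (h1 : ¬ (b' = m₂ - s ∧ d' = s))
    (h2 : ¬ (a' + 1 = m₁ - s ∧ d' = s)) (h3 : ¬ (a' = m₁ - s ∧ d' + 1 = s)) :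
    (b' : ℚ) * w3B n j m₁ m₂ s a' (b' - 1) d' = (b' : ℚ) * supB n j m₁ m₂ (a' + d') (b' - 1 + d') := by
  rcases Nat.eq_zero_or_pos b' with h0 | hpos
  · subst h0
    simp
  · rw [w3B_sup (by omega) h2 h3]

/-- `(d' : ℚ) * w3D a' b' (d' − 1)` is the superposition term unless the column is touched. -/
theorem coef_w3D {n j m₁ m₂ s a' b' d' : ℕ} (h1 : ¬ (a' = m₁ - s ∧ d' = s)) (h2 : ¬ (b' = m₂ - s ∧ d' = s)) :
    (d' : ℚ) * w3D n j m₁ m₂ s a' b' (d' - 1) = (d' : ℚ) * supD n j m₁ m₂ (a' + (d' - 1)) (b' + (d' - 1)) := by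
  rcases Nat.eq_zero_or_pos d' with h0 | hpos
  · subst h0
    simp
  · rw [w3D_sup (by omega) (by omega)]

/-! ### The row identity on every realisable profile -/

/-- **THE ROW IDENTITY**: every realisable row `(a, b, d)` sums to `1`. -/
theorem w3_row {n j m₁ m₂ s : ℕ} (hm₁ : 1 ≤ m₁) (hm₁j : m₁ ≤ j) (hm₂ : 1 ≤ m₂) (hm₂j : m₂ ≤ j)
    (hs₁ : s + 1 ≤ m₁) (hs₂ : s + 1 ≤ m₂) (hbig : j + 2 ≤ m₁ + m₂ - s) (hn : 2 * j + 1 ≤ n) (a b d : ℕ)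
    (ha : a ≤ m₁ - s) (hb : b ≤ m₂ - s) (hd : d ≤ s) (h1 : ¬ (a = m₁ - s ∧ d = s)) (h2 : ¬ (b = m₂ - s ∧ d = s))
    (hab : a + b + d ≤ j) :
    (((m₁ - s : ℕ) : ℚ) - a) * w3A n j m₁ m₂ s a b d + (((m₂ - s : ℕ) : ℚ) - b) * w3B n j m₁ m₂ s a b d +
      ((s : ℚ) - d) * w3D n j m₁ m₂ s a b d +
      ((n : ℚ) - j - ((m₁ - s : ℕ) : ℚ) - ((m₂ - s : ℕ) : ℚ) - s + a + b + d) * w3R n j m₁ m₂ s a b d = 1 := by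
  -- the mirror instance, used for the cases of `C₂`
  have hmirror :
      (((m₂ - s : ℕ) : ℚ) - b) * w3A n j m₂ m₁ s b a d + (((m₁ - s : ℕ) : ℚ) - a) * w3B n j m₂ m₁ s b a d +
        ((s : ℚ) - d) * w3D n j m₂ m₁ s b a d +
        ((n : ℚ) - j - ((m₂ - s : ℕ) : ℚ) - ((m₁ - s : ℕ) : ℚ) - s + b + a + d) * w3R n j m₂ m₁ s b a d = 1 →
      (((m₁ - s : ℕ) : ℚ) - a) * w3A n j m₁ m₂ s a b d + (((m₂ - s : ℕ) : ℚ) - b) * w3B n j m₁ m₂ s a b d +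
        ((s : ℚ) - d) * w3D n j m₁ m₂ s a b d +
        ((n : ℚ) - j - ((m₁ - s : ℕ) : ℚ) - ((m₂ - s : ℕ) : ℚ) - s + a + b + d) * w3R n j m₁ m₂ s a b d = 1 := by
    intro h
    rw [w3A_symm n j m₁ m₂ s a b d, w3B_symm n j m₁ m₂ s a b d, w3D_symm n j m₁ m₂ s a b d,
      w3R_symm n j m₁ m₂ s a b d]
    linear_combination h
  by_cases hI : a + 1 = m₁ - s ∧ d = s
  · have ha' : a = m₁ - s - 1 := by omega
    subst ha'
    rw [hI.2]
    by_cases hI' : b + 1 = m₂ - s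
    · have hb' : b = m₂ - s - 1 := by omega
      subst hb'
      exact row_corner3 hm₁j hm₂j hs₁ hs₂ (by omega) hn
    · exact row_typeI hm₁ hm₁j hm₂ hm₂j hn hs₁ (by omega) (by omega) (by omega)
  by_cases hI' : b + 1 = m₂ - s ∧ d = s
  · have hb' : b = m₂ - s - 1 := by omega
    subst hb'
    apply hmirror
    rw [hI'.2]
    exact row_typeI hm₂ hm₂j hm₁ hm₁j hn hs₂ (by omega) (by omega) (by omega)
  by_cases hII : a = m₁ - s ∧ d + 1 = s
  · have ha' : a = m₁ - s := hII.1
    have hd' : d = s - 1 := by omega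
    subst ha' hd'
    exact row_typeII hm₁ hm₁j hm₂ hm₂j hn (by omega) (by omega) (by omega) (by omega) (by omega)
  by_cases hII' : b = m₂ - s ∧ d + 1 = s
  · have hb' : b = m₂ - s := hII'.1
    have hd' : d = s - 1 := by omega
    subst hb' hd'
    apply hmirror
    exact row_typeII hm₂ hm₂j hm₁ hm₁j hn (by omega) (by omega) (by omega) (by omega) (by omega)
  · -- the interior
    have hrow := sup3_row (n := n) (j := j) (m₁ := m₁) (m₂ := m₂) (s := s) (a := a) (b := b) (d := d)
      hm₁ hm₁j hm₂ hm₂j hn (by omega) (by omega) (by omega) (by omega)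
    rw [w3A_sup hI hI' (by omega), w3B_sup hI' hI (by omega), w3D_sup (by omega) (by omega),
      w3R_sup hI hI' (by omega) (by omega)]
    exact hrow

/-! ### The column identities -/

/-- The `+B` correction of the row at `b' − 1` and the `+R` correction of the row at `b'` cancel term for term:
`b'·gBeta (b' − 1) + (j + 2 − m₁ − b')·gGamma b' = 0` (`m₁ + b' ≤ j + 2`, `b' + s ≤ m₂`). -/
theorem gBeta_gGamma_cancel {n j m₁ m₂ s b' : ℕ} (hbL : m₁ + b' ≤ j + 2) (hbs : b' + s ≤ m₂) :
    (b' : ℚ) * gBeta n j m₁ m₂ s (b' - 1) + ((j : ℚ) + 2 - m₁ - b') * gGamma n j m₁ m₂ s b' = 0 := by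
  rcases Nat.eq_zero_or_pos b' with h0 | hpos
  · subst h0
    unfold gGamma
    simp
  · unfold gBeta gGamma
    have e1 : ((j + 1 - m₁ - (b' - 1) : ℕ) : ℚ) = (j : ℚ) + 2 - m₁ - b' := by
      rw [show j + 1 - m₁ - (b' - 1) = j + 2 - (m₁ + b') by omega, Nat.cast_sub hbL]
      push_cast
      ring
    have e2 : m₂ - s - (b' - 1) = m₂ - s + 1 - b' := by omega
    have e3 : b' - 1 + s = b' + s - 1 := by omega
    rw [e1, e2, e3]
    ring

/-- **The untouched column `(#A − 1, b', s)`** above the type-I rows (`b' + 2 ≤ #B`, `m₁ + b' ≤ j + 2`) sums to `twoK`. -/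
theorem col_typeI {n j m₁ m₂ s b' : ℕ} (hm₁ : 1 ≤ m₁) (hm₁j : m₁ ≤ j) (hm₂ : 1 ≤ m₂) (hm₂j : m₂ ≤ j)
    (hn : 2 * j + 1 ≤ n) (hs₁ : s + 1 ≤ m₁) (hs₂ : s ≤ m₂) (hb : b' + 2 ≤ m₂ - s) (hbL : m₁ + b' ≤ j + 2) :
    ((m₁ - s - 1 : ℕ) : ℚ) * w3A n j m₁ m₂ s (m₁ - s - 1 - 1) b' s + (b' : ℚ) * w3B n j m₁ m₂ s (m₁ - s - 1) (b' - 1) s +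
      (s : ℚ) * w3D n j m₁ m₂ s (m₁ - s - 1) b' (s - 1) +
      ((j : ℚ) + 1 - ((m₁ - s - 1 : ℕ) : ℚ) - b' - s) * w3R n j m₁ m₂ s (m₁ - s - 1) b' s = twoK n j m₁ m₂ := by
  have hcol := sup3_col (n := n) (j := j) (m₁ := m₁) (m₂ := m₂) (a' := m₁ - s - 1) (b' := b') (d' := s)
    hm₁ hm₁j hm₂ hm₂j hn (by omega) (by omega)
  have hcanc := gBeta_gGamma_cancel (n := n) (j := j) (m₁ := m₁) (m₂ := m₂) (s := s) (b' := b') hbL (by omega)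
  rw [coef_w3A (by omega) (by omega) (by omega), coef_w3D (by omega) (by omega)]
  have e1 : m₁ - s - 1 + s = m₁ - 1 := by omega
  rw [e1] at hcol
  have hB : (b' : ℚ) * w3B n j m₁ m₂ s (m₁ - s - 1) (b' - 1) s =
      (b' : ℚ) * (supB n j m₁ m₂ (m₁ - 1) (b' - 1 + s) + gBeta n j m₁ m₂ s (b' - 1)) := by
    rcases Nat.eq_zero_or_pos b' with h0 | hpos
    · subst h0
      simp
    · unfold w3B
      split_ifs <;> first | rfl | (exfalso; omega)
  have hR : w3R n j m₁ m₂ s (m₁ - s - 1) b' s = supR n j m₁ m₂ (m₁ - 1) (b' + s) + gGamma n j m₁ m₂ s b' := by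
    unfold w3R
    split_ifs <;> first | rfl | (exfalso; omega)
  rw [hB, hR]
  have c1 : ((m₁ - s - 1 : ℕ) : ℚ) = (m₁ : ℚ) - s - 1 := by
    rw [Nat.cast_sub (by omega), Nat.cast_sub (by omega)]
    push_cast
    ring
  have hcoef : (j : ℚ) + 1 - ((m₁ - s - 1 : ℕ) : ℚ) - b' - s = (j : ℚ) + 2 - m₁ - b' := by
    rw [c1]
    ring
  rw [hcoef] at hcol ⊢
  rw [c1] at hcol ⊢
  linear_combination hcol + hcanc

/-- **The untouched column `(#A, b', s − 1)`** above the type-II rows (`1 ≤ s`, `b' + 1 ≤ #B`, `m₁ + b' ≤ j + 2`)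
sums to `twoK`. -/
theorem col_typeII {n j m₁ m₂ s b' : ℕ} (hm₁ : 1 ≤ m₁) (hm₁j : m₁ ≤ j) (hm₂ : 1 ≤ m₂) (hm₂j : m₂ ≤ j)
    (hn : 2 * j + 1 ≤ n) (hs : 1 ≤ s) (hs₁ : s ≤ m₁) (hs₂ : s ≤ m₂) (hb : b' + 1 ≤ m₂ - s) (hbL : m₁ + b' ≤ j + 2) :
    ((m₁ - s : ℕ) : ℚ) * w3A n j m₁ m₂ s (m₁ - s - 1) b' (s - 1) + (b' : ℚ) * w3B n j m₁ m₂ s (m₁ - s) (b' - 1) (s - 1) +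
      ((s - 1 : ℕ) : ℚ) * w3D n j m₁ m₂ s (m₁ - s) b' (s - 1 - 1) +
      ((j : ℚ) + 1 - ((m₁ - s : ℕ) : ℚ) - b' - ((s - 1 : ℕ) : ℚ)) * w3R n j m₁ m₂ s (m₁ - s) b' (s - 1) =
      twoK n j m₁ m₂ := by
  have hcol := sup3_col (n := n) (j := j) (m₁ := m₁) (m₂ := m₂) (a' := m₁ - s) (b' := b') (d' := s - 1)
    hm₁ hm₁j hm₂ hm₂j hn (by omega) (by omega)
  have hcanc := gBeta_gGamma_cancel (n := n) (j := j) (m₁ := m₁) (m₂ := m₂) (s := s) (b' := b') hbL (by omega)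
  rw [coef_w3A (by omega) (by omega) (by omega), coef_w3D (by omega) (by omega)]
  have e1 : m₁ - s + (s - 1) = m₁ - 1 := by omega
  have e2 : b' - 1 + (s - 1) = b' - 1 + s - 1 := by omega
  have e3 : b' + (s - 1) = b' + s - 1 := by omega
  rw [e1, e2, e3] at hcol
  rw [e3]
  have hB : (b' : ℚ) * w3B n j m₁ m₂ s (m₁ - s) (b' - 1) (s - 1) =
      (b' : ℚ) * (supB n j m₁ m₂ (m₁ - 1) (b' - 1 + s - 1) + gBeta n j m₁ m₂ s (b' - 1)) := by
    rcases Nat.eq_zero_or_pos b' with h0 | hpos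
    · subst h0
      simp
    · unfold w3B
      split_ifs <;> first | rfl | (exfalso; omega)
  have hR : w3R n j m₁ m₂ s (m₁ - s) b' (s - 1) =
      supR n j m₁ m₂ (m₁ - 1) (b' + s - 1) + gGamma n j m₁ m₂ s b' := by
    unfold w3R
    split_ifs <;> first | rfl | (exfalso; omega)
  rw [hB, hR]
  have c1 : ((m₁ - s : ℕ) : ℚ) = (m₁ : ℚ) - s := by rw [Nat.cast_sub hs₁]
  have c2 : ((s - 1 : ℕ) : ℚ) = (s : ℚ) - 1 := by
    rw [Nat.cast_sub hs]
    push_cast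
    ring
  have hcoef : (j : ℚ) + 1 - ((m₁ - s : ℕ) : ℚ) - b' - ((s - 1 : ℕ) : ℚ) = (j : ℚ) + 2 - m₁ - b' := by
    rw [c1, c2]
    ring
  rw [hcoef] at hcol ⊢
  rw [c1, c2] at hcol ⊢
  linear_combination hcol + hcanc

end PercRepro.PuncturedLYM
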